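import Mathlib
import Summits.Ventures.PercRepro2.SwOutCrossGenJointThm
import Summits.Ventures.PercRepro2.SwOutCrossGenSumLink

/-!
# Two cross components as one fibre: the joint label and the glued fibre (blind cell PercRepro2,
night-4 g25, 2026-08-28; proofs/NIGHT4-G25.md §2)

The JOINT label of two components at one junction is the label `labelKE` of the disjoint-union
graph `G₁ ⊕g G₂` at the glued point: outside bits, red links between red ports and blue links
between blue ports in the link graph of the sum — so a link across the components is recorded
exactly when both ends are attached (`rlinkE_glue_inl_inr`).  The four comparisons of
`JointLabel` hold for it: at a UNIFORM (core) point `c` of the second component no link across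
the components touches a port of `c` (`labelKE_glue_core`: the joint label is `gKE` of the first
label and `c`), `gKE` is monotone (`gKE_mono`), and along the slab injections the SOURCE has no
cross link between red ports (no red-side leak: its red ports are unattached) while the IMAGE has
no cross link between blue ports (no blue-side leak: its blue ports are not blue-linked to `u`)
— `betterKE_glue`.  Hence **`jointKE`** is a `JointLabel` for any first fibre with the `KE`
fields and a connected second component, and **`fibKEESum`** is the glued fibre on
`FibKE (X₁ ⊕ X₂) (G₁ ⊕g G₂)` with the `KE` fields again (so that it iterates), its injection
`theta` being `theta₁ × thetaKE` through the gluing.  Its inequality is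
`SwOutCrossGenSumIneq`.
-/

namespace Summit.Ventures.PercRepro2

namespace CrossArm

open Classical

section GKE

variable {X₁ X₂ : Type*} (G₂ : SimpleGraph X₂)

/-- The joint label at a uniform second component `c`, through the first label `l`: the outside
bits of both, the links of each part, no link across. -/
def gKE (l : LabelKE X₁) (c : FibKE X₂ G₂) : LabelKE (X₁ ⊕ X₂) :=
  (Sum.elim l.1 c.2.2,
    fun x y => match x, y with
      | Sum.inl i, Sum.inl j => l.2.1 i j
      | Sum.inr i, Sum.inr j => (labelKE G₂ c).2.1 i j
      | _, _ => False,
    fun x y => match x, y with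
      | Sum.inl i, Sum.inl j => l.2.2 i j
      | Sum.inr i, Sum.inr j => (labelKE G₂ c).2.2 i j
      | _, _ => False)

/-- `gKE` is monotone in both arguments. -/
lemma gKE_mono {l l' : LabelKE X₁} {c c' : FibKE X₂ G₂} (h : BetterKE l' l)
    (hc : BetterKE (labelKE G₂ c') (labelKE G₂ c)) : BetterKE (gKE G₂ l' c') (gKE G₂ l c) := by
  refine ⟨fun x hx => ?_, fun x y hxy => ?_, fun x y hxy => ?_⟩
  · rcases x with i | i
    · exact h.1 i hx
    · exact hc.1 i hx
  · rcases x with i | i <;> rcases y with j | j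
    · exact h.2.1 i j hxy
    · exact hxy.elim
    · exact hxy.elim
    · exact hc.2.1 i j hxy
  · rcases x with i | i <;> rcases y with j | j
    · exact h.2.2 i j hxy
    · exact hxy.elim
    · exact hxy.elim
    · exact hc.2.2 i j hxy

/-- A red port of a uniform point is not attached. -/
lemma not_attE_of_coreKE_red {c : FibKE X₂ G₂} (hc : coreKE c = true) {j : X₂}
    (he : c.2.2 j = false) : ¬ attE G₂ c j := by
  obtain ⟨b, hb1, hb2⟩ := (coreKE_eq_true_iff c).1 hc
  cases b with
  | false => exact not_attE_of_uP_false G₂ hb1 j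
  | true => rw [hb2 j] at he; exact Bool.noConfusion he

/-- A blue port of a uniform point is not attached in the flip. -/
lemma not_attE_flip_of_coreKE_blue {c : FibKE X₂ G₂} (hc : coreKE c = true) {j : X₂}
    (he : c.2.2 j = true) : ¬ attE G₂ c.flip j := by
  obtain ⟨b, hb1, hb2⟩ := (coreKE_eq_true_iff c).1 hc
  cases b with
  | true =>
    refine not_attE_of_uP_false G₂ (fun i => ?_) j
    show (!c.1 i) = false
    rw [hb1 i]; rfl
  | false => rw [hb2 j] at he; exact Bool.noConfusion he

variable (G₁ : SimpleGraph X₁)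

/-- **At a uniform second component the joint label is `gKE` of the first label**: no link across
the components touches a port of the uniform part. -/
lemma labelKE_glue_core (w₁ : FibKE X₁ G₁) {c : FibKE X₂ G₂} (hc : coreKE c = true) :
    labelKE (G₁ ⊕g G₂) (glueKE G₁ G₂ w₁ c) = gKE G₂ (labelKE G₁ w₁) c := by
  refine Prod.ext rfl (Prod.ext ?_ ?_)
  · funext x y
    rcases x with i | i <;> rcases y with j | j
    · show (w₁.2.2 i = false ∧ w₁.2.2 j = false ∧ rlinkE (G₁ ⊕g G₂) (glueKE G₁ G₂ w₁ c)
          (Sum.inl i) (Sum.inl j)) = (w₁.2.2 i = false ∧ w₁.2.2 j = false ∧ rlinkE G₁ w₁ i j)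
      rw [rlinkE_glue_inl_inl]
    · show (w₁.2.2 i = false ∧ c.2.2 j = false ∧ rlinkE (G₁ ⊕g G₂) (glueKE G₁ G₂ w₁ c)
          (Sum.inl i) (Sum.inr j)) = False
      rw [rlinkE_glue_inl_inr]
      apply propext
      exact ⟨fun h => not_attE_of_coreKE_red G₂ hc h.2.1 h.2.2.2, False.elim⟩
    · show (c.2.2 i = false ∧ w₁.2.2 j = false ∧ rlinkE (G₁ ⊕g G₂) (glueKE G₁ G₂ w₁ c)
          (Sum.inr i) (Sum.inl j)) = False
      rw [rlinkE_glue_inr_inl]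
      apply propext
      exact ⟨fun h => not_attE_of_coreKE_red G₂ hc h.1 h.2.2.1, False.elim⟩
    · show (c.2.2 i = false ∧ c.2.2 j = false ∧ rlinkE (G₁ ⊕g G₂) (glueKE G₁ G₂ w₁ c)
          (Sum.inr i) (Sum.inr j)) = (c.2.2 i = false ∧ c.2.2 j = false ∧ rlinkE G₂ c i j)
      rw [rlinkE_glue_inr_inr]
  · funext x y
    rcases x with i | i <;> rcases y with j | j
    · show (w₁.2.2 i = true ∧ w₁.2.2 j = true ∧ rlinkE (G₁ ⊕g G₂) (glueKE G₁ G₂ w₁ c).flip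
          (Sum.inl i) (Sum.inl j)) = (w₁.2.2 i = true ∧ w₁.2.2 j = true ∧ rlinkE G₁ w₁.flip i j)
      rw [← glueKE_flip, rlinkE_glue_inl_inl]
    · show (w₁.2.2 i = true ∧ c.2.2 j = true ∧ rlinkE (G₁ ⊕g G₂) (glueKE G₁ G₂ w₁ c).flip
          (Sum.inl i) (Sum.inr j)) = False
      rw [← glueKE_flip, rlinkE_glue_inl_inr]
      apply propext
      exact ⟨fun h => not_attE_flip_of_coreKE_blue G₂ hc h.2.1 h.2.2.2, False.elim⟩
    · show (c.2.2 i = true ∧ w₁.2.2 j = true ∧ rlinkE (G₁ ⊕g G₂) (glueKE G₁ G₂ w₁ c).flip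
          (Sum.inr i) (Sum.inl j)) = False
      rw [← glueKE_flip, rlinkE_glue_inr_inl]
      apply propext
      exact ⟨fun h => not_attE_flip_of_coreKE_blue G₂ hc h.1 h.2.2.1, False.elim⟩
    · show (c.2.2 i = true ∧ c.2.2 j = true ∧ rlinkE (G₁ ⊕g G₂) (glueKE G₁ G₂ w₁ c).flip
          (Sum.inr i) (Sum.inr j)) = (c.2.2 i = true ∧ c.2.2 j = true ∧ rlinkE G₂ c.flip i j)
      rw [← glueKE_flip, rlinkE_glue_inr_inr]

/-- **The joint label improves along a pair of component improvements** when the source has no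
red-side leak (its red ports are unattached, so no red link crosses) and the image has no
blue-side leak (its blue ports are not blue-linked to `u`, so no blue link crosses). -/
lemma betterKE_glue {w₁ w₁' : FibKE X₁ G₁} {w₂ w₂' : FibKE X₂ G₂}
    (h₁ : BetterKE (labelKE G₁ w₁') (labelKE G₁ w₁))
    (h₂ : BetterKE (labelKE G₂ w₂') (labelKE G₂ w₂))
    (hs₁ : leakKE G₁ w₁ = false) (hs₂ : leakKE G₂ w₂ = false)
    (ht₁ : leakKE G₁ w₁'.flip = false) (ht₂ : leakKE G₂ w₂'.flip = false) :
    BetterKE (labelKE (G₁ ⊕g G₂) (glueKE G₁ G₂ w₁' w₂')) (labelKE (G₁ ⊕g G₂) (glueKE G₁ G₂ w₁ w₂)) := by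
  rw [leakKE_eq_false_iff] at hs₁ hs₂ ht₁ ht₂
  refine ⟨fun x hx => ?_, fun x y hxy => ?_, fun x y hxy => ?_⟩
  · rcases x with i | i
    · exact h₁.1 i hx
    · exact h₂.1 i hx
  · rcases x with i | i <;> rcases y with j | j
    · obtain ⟨hi, hj, hl⟩ := hxy
      rw [rlinkE_glue_inl_inl] at hl
      obtain ⟨hi', hj', hl'⟩ := h₁.2.1 i j ⟨hi, hj, hl⟩
      exact ⟨hi', hj', (rlinkE_glue_inl_inl G₁ G₂ w₁' w₂' i j).2 hl'⟩
    · obtain ⟨hi, -, hl⟩ := hxy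
      rw [rlinkE_glue_inl_inr] at hl
      have hi' : w₁.2.2 i = false := hi
      have := hs₁ i hl.1
      rw [this] at hi'
      exact Bool.noConfusion hi'
    · obtain ⟨hi, -, hl⟩ := hxy
      rw [rlinkE_glue_inr_inl] at hl
      have hi' : w₂.2.2 i = false := hi
      have := hs₂ i hl.1
      rw [this] at hi'
      exact Bool.noConfusion hi'
    · obtain ⟨hi, hj, hl⟩ := hxy
      rw [rlinkE_glue_inr_inr] at hl
      obtain ⟨hi', hj', hl'⟩ := h₂.2.1 i j ⟨hi, hj, hl⟩
      exact ⟨hi', hj', (rlinkE_glue_inr_inr G₁ G₂ w₁' w₂' i j).2 hl'⟩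
  · rcases x with i | i <;> rcases y with j | j
    · obtain ⟨hi, hj, hl⟩ := hxy
      rw [← glueKE_flip, rlinkE_glue_inl_inl] at hl
      obtain ⟨hi', hj', hl'⟩ := h₁.2.2 i j ⟨hi, hj, hl⟩
      refine ⟨hi', hj', ?_⟩
      rw [← glueKE_flip, rlinkE_glue_inl_inl]
      exact hl'
    · obtain ⟨hi, -, hl⟩ := hxy
      rw [← glueKE_flip, rlinkE_glue_inl_inr] at hl
      exfalso
      have hi' : w₁'.2.2 i = true := hi
      have h' : (!w₁'.2.2 i) = true := ht₁ i hl.1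
      rw [hi'] at h'
      exact Bool.noConfusion h'
    · obtain ⟨hi, -, hl⟩ := hxy
      rw [← glueKE_flip, rlinkE_glue_inr_inl] at hl
      exfalso
      have hi' : w₂'.2.2 i = true := hi
      have h' : (!w₂'.2.2 i) = true := ht₂ i hl.1
      rw [hi'] at h'
      exact Bool.noConfusion h'
    · obtain ⟨hi, hj, hl⟩ := hxy
      rw [← glueKE_flip, rlinkE_glue_inr_inr] at hl
      obtain ⟨hi', hj', hl'⟩ := h₂.2.2 i j ⟨hi, hj, hl⟩
      refine ⟨hi', hj', ?_⟩
      rw [← glueKE_flip, rlinkE_glue_inr_inr]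
      exact hl'

end GKE

section Joint

variable {X₁ X₂ : Type*} {G₁ : SimpleGraph X₁} (G₂ : SimpleGraph X₂) [Fintype X₂] [DecidableEq X₂]
  [DecidableRel G₂.Adj] [Nonempty X₂] (hG₂ : G₂.Connected)
  (F₁ : FibreIter (FibKE X₁ G₁) (AtomKEE X₁ G₁) (LabelKE X₁))
  (hflip : F₁.flip = FibKE.flip) (hleak : F₁.leakR = leakKE G₁)
  (hlab : F₁.label = labelKE G₁) (hB : F₁.BetterL = BetterKE)

include hflip hleak hlab hB

/-- **The joint label of two components at one junction** (`labelKE` of the sum graph at the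
glued point) is a `JointLabel`. -/
def jointKE : JointLabel F₁ (fibKEEBit G₂ hG₂) (LabelKE (X₁ ⊕ X₂)) where
  labelJ := fun w₁ w₂ => labelKE (G₁ ⊕g G₂) (glueKE G₁ G₂ w₁ w₂)
  BetterJ := BetterKE
  betterJ_refl := BetterKE_refl
  g := fun l c => gKE G₂ l c
  labelJ_core := fun w₁ c hc => by
    rw [hlab]
    exact labelKE_glue_core G₂ G₁ w₁ hc
  g_mono := fun l l' c _ h => by
    rw [hB] at h
    exact gKE_mono G₂ h (BetterKE_refl _)
  pairJ := fun w₁ c hc => by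
    have hc0 : coreKE c = true := core0KE_core G₂ c hc
    have hc1 : coreKE c.flip = true := coreKE_flip c hc0
    show BetterKE (labelKE (G₁ ⊕g G₂) (glueKE G₁ G₂ w₁ c))
      (labelKE (G₁ ⊕g G₂) (glueKE G₁ G₂ w₁ c.flip))
    rw [labelKE_glue_core G₂ G₁ w₁ hc0, labelKE_glue_core G₂ G₁ w₁ hc1]
    exact gKE_mono G₂ (BetterKE_refl _) (pair_labelKE G₂ c hc)
  ncJ := fun w₁ w₂ h₁ h₂ hc => by
    have h₁' : leakKE G₁ w₁ = false := by rw [← hleak]; exact h₁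
    obtain ⟨ht₁, hl₁, -⟩ := F₁.theta_ok w₁ h₁
    rw [hleak, hflip] at ht₁
    rw [hlab, hB] at hl₁
    obtain ⟨ht₂, -, hl₂, -⟩ := psiKE_ok G₂ w₂ h₂ hc
    exact betterKE_glue G₂ G₁ hl₁ hl₂ h₁' h₂ ht₁ ht₂
  thetaJ := fun w₁ w₂ h₁ h₂ => by
    have h₁' : leakKE G₁ w₁ = false := by rw [← hleak]; exact h₁
    obtain ⟨ht₁, hl₁, -⟩ := F₁.theta_ok w₁ h₁
    rw [hleak, hflip] at ht₁
    rw [hlab, hB] at hl₁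
    obtain ⟨ht₂, hl₂, -⟩ := thetaKE_ok G₂ w₂ h₂
    exact betterKE_glue G₂ G₁ hl₁ hl₂ h₁' h₂ ht₁ ht₂

omit [Fintype X₂] [DecidableEq X₂] [DecidableRel G₂.Adj] hleak hlab hB in
/-- The red edge atoms of a glued point are carried by the flip of `theta₁ × theta₂`. -/
lemma redKEE_glue_theta {w₁ : FibKE X₁ G₁} {w₂ : FibKE X₂ G₂} (h₁ : F₁.leakR w₁ = false)
    (h₂ : leakKE G₂ w₂ = false) (hred : F₁.red = redKEE G₁)
    (a : AtomKEE (X₁ ⊕ X₂) (G₁ ⊕g G₂))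
    (ha : redKEE (G₁ ⊕g G₂) (glueKE G₁ G₂ w₁ w₂) a = true) :
    redKEE (G₁ ⊕g G₂) (glueKE G₁ G₂ (F₁.theta w₁) (thetaKE G₂ w₂)).flip a = true := by
  obtain ⟨-, -, hr₁⟩ := F₁.theta_ok w₁ h₁
  rw [hred, hflip] at hr₁
  obtain ⟨-, -, hr₂⟩ := thetaKE_ok G₂ w₂ h₂
  rw [← glueKE_flip]
  rcases a with (i | i) | s
  · rw [redKEE_glue_inl] at ha ⊢
    exact hr₁ _ ha
  · rw [redKEE_glue_inr] at ha ⊢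
    exact hr₂ _ ha
  · obtain ⟨s', rfl⟩ := (SimpleGraph.edgeSetSumEquiv (G := G₁) (H := G₂)).symm.surjective s
    rcases s' with s₁ | s₂
    · rw [redKEE_glue_edge_inl] at ha ⊢
      exact hr₁ _ ha
    · rw [redKEE_glue_edge_inr] at ha ⊢
      exact hr₂ _ ha

/-- **The glued fibre of two components**, with the `KE` fields and the injection `theta₁ × thetaKE`
through the gluing. -/
noncomputable def fibKEESum (hred : F₁.red = redKEE G₁) :
    FibreIter (FibKE (X₁ ⊕ X₂) (G₁ ⊕g G₂)) (AtomKEE (X₁ ⊕ X₂) (G₁ ⊕g G₂)) (LabelKE (X₁ ⊕ X₂)) where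
  flip := FibKE.flip
  flip_flip := FibKE.flip_flip
  red := redKEE (G₁ ⊕g G₂)
  leakR := leakKE (G₁ ⊕g G₂)
  label := labelKE (G₁ ⊕g G₂)
  BetterL := BetterKE
  betterL_refl := BetterKE_refl
  theta := fun w => glueKE G₁ G₂ (F₁.theta (splitKE G₁ G₂ w).1) (thetaKE G₂ (splitKE G₁ G₂ w).2)
  theta_ok := fun w hw => by
    have hw' : w = glueKE G₁ G₂ (splitKE G₁ G₂ w).1 (splitKE G₁ G₂ w).2 :=
      (glueKE_splitKE G₁ G₂ w).symm
    set w₁ := (splitKE G₁ G₂ w).1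
    set w₂ := (splitKE G₁ G₂ w).2
    rw [hw', leakKE_glue, Bool.or_eq_false_iff] at hw
    obtain ⟨h₁, h₂⟩ := hw
    have h₁' : F₁.leakR w₁ = false := by rw [hleak]; exact h₁
    obtain ⟨ht₁, hl₁, -⟩ := F₁.theta_ok w₁ h₁'
    rw [hleak, hflip] at ht₁
    rw [hlab, hB] at hl₁
    obtain ⟨ht₂, hl₂, -⟩ := thetaKE_ok G₂ w₂ h₂
    refine ⟨?_, ?_, ?_⟩
    · rw [← glueKE_flip, leakKE_glue, ht₁, ht₂]; rfl
    · rw [hw']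
      exact betterKE_glue G₂ G₁ hl₁ hl₂ h₁ h₂ ht₁ ht₂
    · intro a ha
      rw [hw'] at ha
      exact redKEE_glue_theta G₂ F₁ hflip h₁' h₂ hred a ha
  theta_inj := fun w w' hw hw' heq => by
    have e : ∀ v : FibKE (X₁ ⊕ X₂) (G₁ ⊕g G₂),
        v = glueKE G₁ G₂ (splitKE G₁ G₂ v).1 (splitKE G₁ G₂ v).2 :=
      fun v => (glueKE_splitKE G₁ G₂ v).symm
    have hw1 := hw
    have hw1' := hw'
    rw [e w, leakKE_glue, Bool.or_eq_false_iff] at hw1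
    rw [e w', leakKE_glue, Bool.or_eq_false_iff] at hw1'
    have hs := congrArg (splitKE G₁ G₂) heq
    rw [splitKE_glueKE, splitKE_glueKE, Prod.mk.injEq] at hs
    have h1 : (splitKE G₁ G₂ w).1 = (splitKE G₁ G₂ w').1 :=
      F₁.theta_inj _ _ (by rw [hleak]; exact hw1.1) (by rw [hleak]; exact hw1'.1) hs.1
    have h2 : (splitKE G₁ G₂ w).2 = (splitKE G₁ G₂ w').2 :=
      thetaKE_inj G₂ _ _ hw1.2 hw1'.2 hs.2
    rw [e w, e w', h1, h2]

end Joint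

end CrossArm

end Summit.Ventures.PercRepro2
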